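import Mathlib
import Summits.ResolutionOfSingularities.ResolutionOfSingularities.Theorems.WeightedInvariantLocalWeightedDropWildMonicFlagDropTangentKMax
import Summits.ResolutionOfSingularities.ResolutionOfSingularities.Theorems.WeightedInvariantLocalWeightedDropWildMonicFlagTripleBasic
import Summits.ResolutionOfSingularities.ResolutionOfSingularities.Theorems.WeightedInvariantLocalWeightedDropWildMonicFlagShearOrder
import Summits.ResolutionOfSingularities.ResolutionOfSingularities.Theorems.WeightedInvariantLocalWeightedDropWildMonicNewtonPointStep
import Summits.ResolutionOfSingularities.ResolutionOfSingularities.Theorems.WeightedInvariantLocalWeightedDropWildPurePowerFlagInvN1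

/-!
# S3ρ flag line, DROP SIDE, (D5) `DropAxisN1Second` — part A: THE PRESENTATION CHANGE of a transversal (`n = 1`) flag of a TUPLE, and
# why the `n = 1` numbers `mFlagN d! 1` / `dFlagN d! 1` do not see it

Crux item stmt-ResolutionOfSingularities-8899 `LocalWeightedDrop` (route `ResolutionOfSingularities/WeightedInvariant`), engine of the
door `HypersurfaceCentreConstruction` stmt-ResolutionOfSingularities-19897.  [OURS · L1 W4.3, chain w43; hand res-D-repro-2 on target (D5)
`DropAxisN1Second` of res-type-083's `…WildMonicFlagDropAxisSplit` (UNCLAIMED-STUB LIST 2026-08-27T08:48:48Z, res-L1-w43-plan-1 DEALS #12,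
res-plan-2 IDLE POOL DEAL #4d); reduction as in res-D-pv-056 AS stub-5's DESIGN HINT 08:58:42Z, with ONE simplification: for `n = 1` only the
TANGENT LINE of the curve enters the numbers, so the first-orientation comparison flag is taken with the LINEAR shear `c⁻¹·X` — no formal
inverse function is needed.  MODEL: S. Perlega, arXiv:2011.14443 Prop. 9.1.4 case (3) (the transversal `n_G = 1` child flag) and §7.2 (b)
(`ω = (1, n_𝓕)`); H. Hauser, S. Perlega, PRIMS 60 (2024) p. 784 «does not depend on the choice of a regular system of parameters subordinate
to 𝓕» — here the one instance needed, for TUPLES (stub-1's `…WildPurePowerFlagInvN1` is the pure-power model).  Every object is OURS; nothing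
here is a statement of H. Hironaka's manuscript [claim: Hironaka2017, status: under-review].  This file is def-free.]

THE ARGUMENT.  A second-orientation flag `(true, g, h)` with `h = c·X + h₂` (`c ≠ 0`, `ord h₂ ≥ 2`), read on the swapped tuple `swapT B`, has
tuple `flagTuple d (swapT B) g h = θ_{h₂}^* τ_c^* (flagTuple d B g̃ (c⁻¹·X))` (`flagTuple_swapT_linShift_add`), where
`τ_c : (x₀, x₁) ↦ (x₁ + c x₀, −c⁻¹ x₁)` is stub-1's linear change (`PurePowerFlag.subst_tau_shear_eq`), `θ_{h₂}` the shear by the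
order-`≥ 2` tail, and `g̃ = τ_c⁻¹^* θ_{−h₂}^* g` (`WildMonic.subst_shift`, `flagTuple_flagTuple`).  Both `τ_c^{±1}` and `θ_{±h₂}` raise no
`![M, N]`-weighted order with `M ≤ N ≤ M · ord h₂` (`weightedOrder_subst_tau`, stub-5's `weightedOrder_subst_shift`), so the scaled slot orders
`wMin ![1,1]` and `wMin ![K, K+1]` (`K ≥ 1`) of the two tuples agree; by stub-5's `K`-weight dictionary (`wOrdN_newtonSet_eq`,
`initHeight_le_of_wMin_kWeight_le`) so do `wOrdN 1` and `initHeight 1` of their Newton sets, hence `mFlagN L 1` and `dFlagN L 1`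
(`mFlagN_dFlagN_eq_of_presentation`).  Part B (`…FlagDropAxisN1Second`) reads off the triples, transports validity, and calls (D2).

* §1 `τ_c`, `τ_c⁻¹` (written out) and their weighted orders; §2 `wMin` is a function of the slot orders; §3 `n = 1` numbers from `wMin ![1,1]`,
  `wMin ![K,K+1]`; §4 the presentation change `flagTuple_swapT_linShift_add` and `mFlagN_dFlagN_eq_of_presentation`.
-/

set_option linter.dupNamespace false -- mandated namespace of this single-conjunct summit

noncomputable section

namespace Summit.ResolutionOfSingularities.ResolutionOfSingularities.Theorems

namespace WildMonic

open MvPowerSeries MonicDescent Literature.AlgebraicGeometry.Resolution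
open Literature.AlgebraicGeometry.Resolution.HauserPerlega2024 (Triple)
open PurePowerFlag (swap swapE IsN0 IsTangent succE)

variable {k : Type} [Field k] {d : ℕ}

/-! ## §1 The linear change `τ_c` between the two presentations and its inverse -/

/-! `τ_c : (x₀, x₁) ↦ (x₁ + c·x₀, −c⁻¹·x₁)` is the substitution `![X 1 + C c * X 0, C (−c⁻¹) * X 1]` (stub-1's `τ` with `g₁ = c`,
`h₁ = c⁻¹`); `τ_c⁻¹ : (x₀, x₁) ↦ (c⁻¹·x₀ + x₁, −c·x₁)` is `![C c⁻¹ * X 0 + X 1, C (−c) * X 1]` (written out; this file is def-free). -/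

/-- The letters of `τ_c` have no constant term. -/
theorem constantCoeff_tau (c : k) (i : Fin 2) : constantCoeff ((![X 1 + MvPowerSeries.C c * X 0, MvPowerSeries.C (-c⁻¹) * X 1] : Fin 2 → MvPowerSeries (Fin 2) k) i) = 0 := by
  fin_cases i <;> simp [constantCoeff_X]

/-- The letters of `τ_c⁻¹` have no constant term. -/
theorem constantCoeff_tauInv (c : k) (i : Fin 2) : constantCoeff ((![MvPowerSeries.C c⁻¹ * X 0 + X 1, MvPowerSeries.C (-c) * X 1] : Fin 2 → MvPowerSeries (Fin 2) k) i) = 0 := by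
  fin_cases i <;> simp [constantCoeff_X]

/-- `τ_c` is substitutable. -/
theorem hasSubst_tau (c : k) : HasSubst (![X 1 + MvPowerSeries.C c * X 0, MvPowerSeries.C (-c⁻¹) * X 1] : Fin 2 → MvPowerSeries (Fin 2) k) := hasSubst_of_constantCoeff_zero (constantCoeff_tau c)

/-- `τ_c⁻¹` is substitutable. -/
theorem hasSubst_tauInv (c : k) : HasSubst (![MvPowerSeries.C c⁻¹ * X 0 + X 1, MvPowerSeries.C (-c) * X 1] : Fin 2 → MvPowerSeries (Fin 2) k) := hasSubst_of_constantCoeff_zero (constantCoeff_tauInv c)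

/-- `τ_c ∘ τ_c⁻¹ = id` on series. -/
theorem subst_tau_subst_tauInv {c : k} (hc : c ≠ 0) (F : MvPowerSeries (Fin 2) k) :
    subst (![X 1 + MvPowerSeries.C c * X 0, MvPowerSeries.C (-c⁻¹) * X 1] : Fin 2 → MvPowerSeries (Fin 2) k) (subst (![MvPowerSeries.C c⁻¹ * X 0 + X 1, MvPowerSeries.C (-c) * X 1] : Fin 2 → MvPowerSeries (Fin 2) k) F) = F := by
  rw [subst_comp_subst_apply (hasSubst_tauInv c) (hasSubst_tau c)]
  have hfun : (fun i => subst (![X 1 + MvPowerSeries.C c * X 0, MvPowerSeries.C (-c⁻¹) * X 1] : Fin 2 → MvPowerSeries (Fin 2) k) ((![MvPowerSeries.C c⁻¹ * X 0 + X 1, MvPowerSeries.C (-c) * X 1] : Fin 2 → MvPowerSeries (Fin 2) k) i)) = (X : Fin 2 → MvPowerSeries (Fin 2) k) := by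
    funext i
    rcases PurePowerFlag.letter_cases i with rfl | rfl
    · rw [Matrix.cons_val_zero, ← coe_substAlgHom (hasSubst_tau c), map_add, map_mul, coe_substAlgHom, subst_C, subst_X (hasSubst_tau c),
        subst_X (hasSubst_tau c), Matrix.cons_val_zero, Matrix.cons_val_one, Matrix.cons_val_zero]
      have : MvPowerSeries.C c⁻¹ * MvPowerSeries.C c = (1 : MvPowerSeries (Fin 2) k) := by
        rw [← map_mul, inv_mul_cancel₀ hc, map_one]
      rw [map_neg]
      linear_combination (X 0 : MvPowerSeries (Fin 2) k) * this
    · rw [Matrix.cons_val_one, Matrix.cons_val_zero, ← coe_substAlgHom (hasSubst_tau c), map_mul, coe_substAlgHom, subst_C, subst_X (hasSubst_tau c), Matrix.cons_val_one, Matrix.cons_val_zero]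
      have : MvPowerSeries.C c * MvPowerSeries.C c⁻¹ = (1 : MvPowerSeries (Fin 2) k) := by
        rw [← map_mul, mul_inv_cancel₀ hc, map_one]
      rw [map_neg, map_neg]
      linear_combination (X 1 : MvPowerSeries (Fin 2) k) * this
  rw [hfun]
  exact congrFun subst_self F

/-- `τ_c⁻¹ ∘ τ_c = id` on series. -/
theorem subst_tauInv_subst_tau {c : k} (hc : c ≠ 0) (F : MvPowerSeries (Fin 2) k) :
    subst (![MvPowerSeries.C c⁻¹ * X 0 + X 1, MvPowerSeries.C (-c) * X 1] : Fin 2 → MvPowerSeries (Fin 2) k) (subst (![X 1 + MvPowerSeries.C c * X 0, MvPowerSeries.C (-c⁻¹) * X 1] : Fin 2 → MvPowerSeries (Fin 2) k) F) = F := by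
  rw [subst_comp_subst_apply (hasSubst_tau c) (hasSubst_tauInv c)]
  have hfun : (fun i => subst (![MvPowerSeries.C c⁻¹ * X 0 + X 1, MvPowerSeries.C (-c) * X 1] : Fin 2 → MvPowerSeries (Fin 2) k) ((![X 1 + MvPowerSeries.C c * X 0, MvPowerSeries.C (-c⁻¹) * X 1] : Fin 2 → MvPowerSeries (Fin 2) k) i)) = (X : Fin 2 → MvPowerSeries (Fin 2) k) := by
    funext i
    rcases PurePowerFlag.letter_cases i with rfl | rfl
    · rw [Matrix.cons_val_zero, ← coe_substAlgHom (hasSubst_tauInv c), map_add, map_mul, coe_substAlgHom, subst_C, subst_X (hasSubst_tauInv c),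
        subst_X (hasSubst_tauInv c), Matrix.cons_val_zero, Matrix.cons_val_one, Matrix.cons_val_zero]
      have : MvPowerSeries.C c * MvPowerSeries.C c⁻¹ = (1 : MvPowerSeries (Fin 2) k) := by
        rw [← map_mul, mul_inv_cancel₀ hc, map_one]
      rw [map_neg]
      linear_combination (X 0 : MvPowerSeries (Fin 2) k) * this
    · rw [Matrix.cons_val_one, Matrix.cons_val_zero, ← coe_substAlgHom (hasSubst_tauInv c), map_mul, coe_substAlgHom, subst_C, subst_X (hasSubst_tauInv c), Matrix.cons_val_one, Matrix.cons_val_zero]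
      have : MvPowerSeries.C c⁻¹ * MvPowerSeries.C c = (1 : MvPowerSeries (Fin 2) k) := by
        rw [← map_mul, inv_mul_cancel₀ hc, map_one]
      rw [map_neg, map_neg]
      linear_combination (X 1 : MvPowerSeries (Fin 2) k) * this
  rw [hfun]
  exact congrFun subst_self F

/-- A substitution whose letters have weighted orders at least the weights does not lower weighted orders. [folklore] -/
theorem weightedOrder_le_weightedOrder_subst_of_le (w : Fin 2 → ℕ) {θ : Fin 2 → MvPowerSeries (Fin 2) k}
    (hθ : ∀ i, constantCoeff (θ i) = 0) (hw : ∀ i, (w i : ℕ∞) ≤ weightedOrder w (θ i)) (F : MvPowerSeries (Fin 2) k) :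
    weightedOrder w F ≤ weightedOrder w (subst θ F) := by
  refine le_trans ?_ (le_weightedOrder_subst _ (hasSubst_of_constantCoeff_zero hθ) F)
  refine le_iInf₂ fun e he => (weightedOrder_le _ he).trans ?_
  rw [Finsupp.weight_apply, Finsupp.weight_apply, Finsupp.sum_fintype _ _ (fun i => by simp),
    Finsupp.sum_fintype _ _ (fun i => by simp), Fin.sum_univ_two, Fin.sum_univ_two]
  simp only [Function.comp_apply, smul_eq_mul, nsmul_eq_mul]
  push_cast
  gcongr
  · exact hw 0
  · exact hw 1

/-- The letters of `τ_c` have `![M, N]`-weighted orders `≥ M`, `≥ N` when `M ≤ N`. -/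
theorem le_weightedOrder_tau (c : k) {M N : ℕ} (hMN : M ≤ N) : ∀ i, ((![M, N] i : ℕ) : ℕ∞) ≤ weightedOrder ![M, N] ((![X 1 + MvPowerSeries.C c * X 0, MvPowerSeries.C (-c⁻¹) * X 1] : Fin 2 → MvPowerSeries (Fin 2) k) i) := by
  intro i
  rcases PurePowerFlag.letter_cases i with rfl | rfl
  · show (M : ℕ∞) ≤ _
    rw [Matrix.cons_val_zero]
    refine le_trans (le_min ?_ ?_) (min_weightedOrder_le_add _)
    · exact le_trans (by exact_mod_cast hMN) (le_weightedOrder_X_one M N)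
    · exact le_trans (le_weightedOrder_X_zero M N) (le_trans le_add_self (le_weightedOrder_mul _))
  · show (N : ℕ∞) ≤ _
    rw [Matrix.cons_val_one, Matrix.cons_val_zero]
    exact le_trans (le_weightedOrder_X_one M N) (le_trans le_add_self (le_weightedOrder_mul _))

/-- The letters of `τ_c⁻¹` have `![M, N]`-weighted orders `≥ M`, `≥ N` when `M ≤ N`. -/
theorem le_weightedOrder_tauInv (c : k) {M N : ℕ} (hMN : M ≤ N) :
    ∀ i, ((![M, N] i : ℕ) : ℕ∞) ≤ weightedOrder ![M, N] ((![MvPowerSeries.C c⁻¹ * X 0 + X 1, MvPowerSeries.C (-c) * X 1] : Fin 2 → MvPowerSeries (Fin 2) k) i) := by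
  intro i
  rcases PurePowerFlag.letter_cases i with rfl | rfl
  · show (M : ℕ∞) ≤ _
    rw [Matrix.cons_val_zero]
    refine le_trans (le_min ?_ ?_) (min_weightedOrder_le_add _)
    · exact le_trans (le_weightedOrder_X_zero M N) (le_trans le_add_self (le_weightedOrder_mul _))
    · exact le_trans (by exact_mod_cast hMN) (le_weightedOrder_X_one M N)
  · show (N : ℕ∞) ≤ _
    rw [Matrix.cons_val_one, Matrix.cons_val_zero]
    exact le_trans (le_weightedOrder_X_one M N) (le_trans le_add_self (le_weightedOrder_mul _))

/-- **`τ_c` PRESERVES every `![M, N]`-weighted order with `M ≤ N`.** -/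
theorem weightedOrder_subst_tau {c : k} (hc : c ≠ 0) {M N : ℕ} (hMN : M ≤ N) (F : MvPowerSeries (Fin 2) k) :
    weightedOrder ![M, N] (subst (![X 1 + MvPowerSeries.C c * X 0, MvPowerSeries.C (-c⁻¹) * X 1] : Fin 2 → MvPowerSeries (Fin 2) k) F) = weightedOrder ![M, N] F := by
  refine le_antisymm ?_ (weightedOrder_le_weightedOrder_subst_of_le _ (constantCoeff_tau c) (le_weightedOrder_tau c hMN) F)
  have h := weightedOrder_le_weightedOrder_subst_of_le _ (constantCoeff_tauInv c) (le_weightedOrder_tauInv c hMN) (subst (![X 1 + MvPowerSeries.C c * X 0, MvPowerSeries.C (-c⁻¹) * X 1] : Fin 2 → MvPowerSeries (Fin 2) k) F)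
  rwa [subst_tauInv_subst_tau hc] at h

/-! ## §2 `wMin` is a function of the slot orders -/

/-- Tuples with the same `w`-orders slot by slot have the same `wMin w`. -/
theorem wMin_congr (w : Fin 2 → ℕ) {C₁ C₂ : Fin d → MvPowerSeries (Fin 2) k}
    (h : ∀ j, weightedOrder w (C₁ j) = weightedOrder w (C₂ j)) : wMin w C₁ = wMin w C₂ := by
  unfold wMin slotWOrd
  exact iInf_congr fun j => by rw [h j]

/-- A series is zero iff its `w`-weighted order is `⊤`. -/
theorem eq_zero_iff_weightedOrder_eq_top (w : Fin 2 → ℕ) (F : MvPowerSeries (Fin 2) k) : F = 0 ↔ weightedOrder w F = ⊤ :=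
  ⟨fun h => by rw [h]; exact weightedOrder_zero w, fun h => (weightedOrder_eq_top_iff w).mp h⟩

/-! ## §3 The `n = 1` numbers are read off `wMin ![1,1]` and `wMin ![K, K+1]` -/

/-- Two tuples with the same scaled slot orders for `![1,1]` and for every `![K, K+1]`, `K ≥ 1`, and the same zero slots have the same
`wOrdN 1` and `initHeight 1` on their Newton sets. -/
theorem wOrdN_one_eq_and_initHeight_one_eq {C₁ C₂ : Fin d → MvPowerSeries (Fin 2) k}
    (h11 : wMin ![1, 1] C₁ = wMin ![1, 1] C₂) (hK : ∀ K : ℕ, 1 ≤ K → wMin ![K, K * 1 + 1] C₁ = wMin ![K, K * 1 + 1] C₂)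
    (hz : ∀ j, C₁ j = 0 ↔ C₂ j = 0) :
    wOrdN 1 (newtonSet C₁) = wOrdN 1 (newtonSet C₂) ∧ initHeight 1 (newtonSet C₁) = initHeight 1 (newtonSet C₂) := by
  have hm : wOrdN 1 (newtonSet C₁) = wOrdN 1 (newtonSet C₂) := by
    rw [wOrdN_newtonSet_eq, wOrdN_newtonSet_eq, h11]
  refine ⟨hm, ?_⟩
  -- empty Newton sets: both empty or both non-empty
  by_cases he : newtonSet C₁ = ∅
  · have he2 : newtonSet C₂ = ∅ := by
      rw [newtonSet_eq_empty_iff] at he ⊢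
      exact fun j => (hz j).mp (he j)
    rw [he, he2]
  have hne1 : (newtonSet C₁).Nonempty := Set.nonempty_iff_ne_empty.mpr he
  have hne2 : (newtonSet C₂).Nonempty := by
    rw [Set.nonempty_iff_ne_empty, Ne, newtonSet_eq_empty_iff]
    intro h2
    exact he ((newtonSet_eq_empty_iff C₁).mpr fun j => (hz j).mpr (h2 j))
  set K := max (initHeight 1 (newtonSet C₁)) (initHeight 1 (newtonSet C₂)) with hKdef
  rcases Nat.eq_zero_or_pos K with hK0 | hKpos
  · have h1 : initHeight 1 (newtonSet C₁) = 0 := by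
      have := le_max_left (initHeight 1 (newtonSet C₁)) (initHeight 1 (newtonSet C₂)); omega
    have h2 : initHeight 1 (newtonSet C₂) = 0 := by
      have := le_max_right (initHeight 1 (newtonSet C₁)) (initHeight 1 (newtonSet C₂)); omega
    rw [h1, h2]
  have hKeq := hK K hKpos
  refine le_antisymm ?_ ?_
  · exact initHeight_le_of_wMin_kWeight_le hne1 hne2 (le_max_left _ _) hm hKeq.le
  · exact initHeight_le_of_wMin_kWeight_le hne2 hne1 (le_max_right _ _) hm.symm hKeq.ge

/-- … hence the same `mFlagN L 1` and `dFlagN L 1`. -/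
theorem mFlagN_one_eq_and_dFlagN_one_eq (L : ℕ) {C₁ C₂ : Fin d → MvPowerSeries (Fin 2) k}
    (h11 : wMin ![1, 1] C₁ = wMin ![1, 1] C₂) (hK : ∀ K : ℕ, 1 ≤ K → wMin ![K, K * 1 + 1] C₁ = wMin ![K, K * 1 + 1] C₂)
    (hz : ∀ j, C₁ j = 0 ↔ C₂ j = 0) :
    mFlagN L 1 (newtonSet C₁) = mFlagN L 1 (newtonSet C₂) ∧ dFlagN L 1 (newtonSet C₁) = dFlagN L 1 (newtonSet C₂) := by
  obtain ⟨hm, hih⟩ := wOrdN_one_eq_and_initHeight_one_eq h11 hK hz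
  have hmF : mFlagN L 1 (newtonSet C₁) = mFlagN L 1 (newtonSet C₂) := by
    unfold mFlagN; rw [hm]
  refine ⟨hmF, ?_⟩
  unfold dFlagN
  rw [hih, hmF]

/-! ## §4 The presentation change on flag tuples -/

section Change

/-! The comparison re-centring is `g̃ = τ_c⁻¹^* θ_{−h₂}^* g`, with inverse `g = θ_{h₂}^* τ_c^* g̃` (written out). -/

/-- `−h₂` has no constant term if `h₂` has none. -/
theorem constantCoeff_neg_eq_zero {h₂ : PowerSeries k} (hh₂ : PowerSeries.constantCoeff h₂ = 0) :
    PowerSeries.constantCoeff (-h₂) = 0 := by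
  rw [map_neg, hh₂, neg_zero]

/-- `θ_{h₂}^* θ_{−h₂}^* = id`. -/
theorem subst_shift_subst_shift_neg {h₂ : PowerSeries k} (hh₂ : PowerSeries.constantCoeff h₂ = 0) (F : MvPowerSeries (Fin 2) k) :
    subst (PurePowerFlag.shift h₂) (subst (PurePowerFlag.shift (-h₂)) F) = F := by
  have h := HauserPerlega2024.subst_shift_subst_shift (0 : Fin 2) 1 (by decide) (-h₂) h₂ (constantCoeff_neg_eq_zero hh₂) hh₂ F
  rw [neg_add_cancel] at h
  exact h.trans (HauserPerlega2024.subst_shift_zero (0 : Fin 2) 1 F)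

/-- `θ_{−h₂}^* θ_{h₂}^* = id`. -/
theorem subst_shift_neg_subst_shift {h₂ : PowerSeries k} (hh₂ : PowerSeries.constantCoeff h₂ = 0) (F : MvPowerSeries (Fin 2) k) :
    subst (PurePowerFlag.shift (-h₂)) (subst (PurePowerFlag.shift h₂) F) = F := by
  have h := HauserPerlega2024.subst_shift_subst_shift (0 : Fin 2) 1 (by decide) h₂ (-h₂) hh₂ (constantCoeff_neg_eq_zero hh₂) F
  rw [add_neg_cancel] at h
  exact h.trans (HauserPerlega2024.subst_shift_zero (0 : Fin 2) 1 F)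

/-- `g̃(θ_{h₂}^* τ_c^* g′) = g′`: the comparison re-centring map is a left inverse of `θ_{h₂}^* τ_c^*`. -/
theorem subst_tauInv_shiftNeg_subst_shift_tau {c : k} (hc : c ≠ 0) {h₂ : PowerSeries k} (hh₂ : PowerSeries.constantCoeff h₂ = 0) (g : MvPowerSeries (Fin 2) k) :
    subst (![MvPowerSeries.C c⁻¹ * X 0 + X 1, MvPowerSeries.C (-c) * X 1] : Fin 2 → MvPowerSeries (Fin 2) k) (subst (PurePowerFlag.shift (-h₂)) (subst (PurePowerFlag.shift h₂) (subst (![X 1 + MvPowerSeries.C c * X 0, MvPowerSeries.C (-c⁻¹) * X 1] : Fin 2 → MvPowerSeries (Fin 2) k) g))) = g := by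
  rw [subst_shift_neg_subst_shift hh₂, subst_tauInv_subst_tau hc]

/-- `θ_{h₂}^* τ_c^* (g̃ g) = g`: … and a right inverse. -/
theorem subst_shift_tau_subst_tauInv_shiftNeg {c : k} (hc : c ≠ 0) {h₂ : PowerSeries k} (hh₂ : PowerSeries.constantCoeff h₂ = 0) (g : MvPowerSeries (Fin 2) k) :
    subst (PurePowerFlag.shift h₂) (subst (![X 1 + MvPowerSeries.C c * X 0, MvPowerSeries.C (-c⁻¹) * X 1] : Fin 2 → MvPowerSeries (Fin 2) k) (subst (![MvPowerSeries.C c⁻¹ * X 0 + X 1, MvPowerSeries.C (-c) * X 1] : Fin 2 → MvPowerSeries (Fin 2) k) (subst (PurePowerFlag.shift (-h₂)) g))) = g := by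
  rw [subst_tau_subst_tauInv hc, subst_shift_subst_shift_neg hh₂]

/-- The comparison re-centring `g̃ = τ_c⁻¹^* θ_{−h₂}^* g` is a legal re-centring (`g̃(0) = 0`). -/
theorem constantCoeff_subst_tauInv_shiftNeg (c : k) {h₂ : PowerSeries k} (hh₂ : PowerSeries.constantCoeff h₂ = 0) {g : MvPowerSeries (Fin 2) k}
    (hg : constantCoeff g = 0) : constantCoeff (subst (![MvPowerSeries.C c⁻¹ * X 0 + X 1, MvPowerSeries.C (-c) * X 1] : Fin 2 → MvPowerSeries (Fin 2) k) (subst (PurePowerFlag.shift (-h₂)) g)) = 0 := by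
  refine constantCoeff_subst_eq_zero (hasSubst_tauInv c) (constantCoeff_tauInv c) ?_
  exact constantCoeff_subst_eq_zero (HauserPerlega2024.hasSubst_shift (0 : Fin 2) 1 (-h₂) (constantCoeff_neg_eq_zero hh₂))
    (PurePowerFlag.constantCoeff_shift (-h₂) (constantCoeff_neg_eq_zero hh₂)) hg

/-- `θ_{h₂}^* τ_c^* g′` is a legal re-centring (`(0) = 0`). -/
theorem constantCoeff_subst_shift_tau (c : k) {h₂ : PowerSeries k} (hh₂ : PowerSeries.constantCoeff h₂ = 0) {g : MvPowerSeries (Fin 2) k}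
    (hg : constantCoeff g = 0) : constantCoeff (subst (PurePowerFlag.shift h₂) (subst (![X 1 + MvPowerSeries.C c * X 0, MvPowerSeries.C (-c⁻¹) * X 1] : Fin 2 → MvPowerSeries (Fin 2) k) g)) = 0 := by
  refine constantCoeff_subst_eq_zero (HauserPerlega2024.hasSubst_shift (0 : Fin 2) 1 h₂ hh₂) (PurePowerFlag.constantCoeff_shift h₂ hh₂) ?_
  exact constantCoeff_subst_eq_zero (hasSubst_tau c) (constantCoeff_tau c) hg

/-- SPLITTING OFF THE TAIL OF THE SHEAR: `flagTuple d A g (h₁ + h₂) = θ_{h₂}^* (flagTuple d A (θ_{−h₂}^* g) h₁)`. -/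
theorem flagTuple_add_eq_subst_shift (A : Fin d → MvPowerSeries (Fin 2) k) (g : MvPowerSeries (Fin 2) k) {h₁ h₂ : PowerSeries k}
    (hh₁ : PowerSeries.constantCoeff h₁ = 0) (hh₂ : PowerSeries.constantCoeff h₂ = 0) :
    flagTuple d A g (h₁ + h₂) = fun j => subst (PurePowerFlag.shift h₂) (flagTuple d A (subst (PurePowerFlag.shift (-h₂)) g) h₁ j) := by
  have h := flagTuple_flagTuple A (subst (PurePowerFlag.shift (-h₂)) g) 0 hh₁ hh₂
  rw [subst_shift_subst_shift_neg hh₂, add_zero] at h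
  rw [← h, flagTuple_def, shift_zero]

/-- THE LINEAR PRESENTATION CHANGE: `flagTuple d (swapT B) g (c·X) = τ_c^* (flagTuple d B (τ_c⁻¹^* g) (c⁻¹·X))`. -/
theorem flagTuple_swapT_linShift {c : k} (hc : c ≠ 0) (B : Fin d → MvPowerSeries (Fin 2) k) (g : MvPowerSeries (Fin 2) k) :
    flagTuple d (swapT B) g (PowerSeries.C c * PowerSeries.X) =
      fun j => subst (![X 1 + MvPowerSeries.C c * X 0, MvPowerSeries.C (-c⁻¹) * X 1] : Fin 2 → MvPowerSeries (Fin 2) k) (flagTuple d B (subst (![MvPowerSeries.C c⁻¹ * X 0 + X 1, MvPowerSeries.C (-c) * X 1] : Fin 2 → MvPowerSeries (Fin 2) k) g) (PowerSeries.C c⁻¹ * PowerSeries.X) j) := by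
  have hinv : c⁻¹ * c = 1 := inv_mul_cancel₀ hc
  have hfun : (fun i => subst (PurePowerFlag.shift (PowerSeries.C c * PowerSeries.X)) (swapT B i)) =
      fun i => subst (![X 1 + MvPowerSeries.C c * X 0, MvPowerSeries.C (-c⁻¹) * X 1] : Fin 2 → MvPowerSeries (Fin 2) k) (subst (PurePowerFlag.shift (PowerSeries.C c⁻¹ * PowerSeries.X)) (B i)) := by
    funext i
    rw [swapT_apply]
    exact (PurePowerFlag.subst_tau_shear_eq (B i) hinv).symm
  funext j
  rw [flagTuple_def, hfun]
  conv_lhs => rw [← subst_tau_subst_tauInv hc g]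
  rw [← subst_shift (hasSubst_tau c), ← flagTuple_def]

/-- **THE PRESENTATION CHANGE**: for `h = c·X + h₂`,
`flagTuple d (swapT B) g h = θ_{h₂}^* τ_c^* (flagTuple d B g̃ (c⁻¹·X))`, `g̃ = τ_c⁻¹^* θ_{−h₂}^* g`. -/
theorem flagTuple_swapT_linShift_add {c : k} (hc : c ≠ 0) (B : Fin d → MvPowerSeries (Fin 2) k) (g : MvPowerSeries (Fin 2) k)
    {h₂ : PowerSeries k} (hh₂ : PowerSeries.constantCoeff h₂ = 0) :
    flagTuple d (swapT B) g (PowerSeries.C c * PowerSeries.X + h₂) =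
      fun j => subst (PurePowerFlag.shift h₂) (subst (![X 1 + MvPowerSeries.C c * X 0, MvPowerSeries.C (-c⁻¹) * X 1] : Fin 2 → MvPowerSeries (Fin 2) k) (flagTuple d B (subst (![MvPowerSeries.C c⁻¹ * X 0 + X 1, MvPowerSeries.C (-c) * X 1] : Fin 2 → MvPowerSeries (Fin 2) k) (subst (PurePowerFlag.shift (-h₂)) g)) (PowerSeries.C c⁻¹ * PowerSeries.X) j)) := by
  rw [flagTuple_add_eq_subst_shift (swapT B) g (PurePowerFlag.constantCoeff_linShift c) hh₂]
  funext j
  rw [flagTuple_swapT_linShift hc]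

/-! ### The numbers of the two tuples agree -/

/-- Slot orders agree for every `![M, N]` with `M ≤ N ≤ 2M` (and `N ≤ M · ord h₂`): `θ_{h₂}^* τ_c^*` preserves them. -/
theorem weightedOrder_subst_shift_subst_tau {c : k} (hc : c ≠ 0) {h₂ : PowerSeries k} (hh₂ : PowerSeries.constantCoeff h₂ = 0)
    {M N : ℕ} (hMN : M ≤ N) (hN : (N : ℕ∞) ≤ M * h₂.order) (F : MvPowerSeries (Fin 2) k) :
    weightedOrder ![M, N] (subst (PurePowerFlag.shift h₂) (subst (![X 1 + MvPowerSeries.C c * X 0, MvPowerSeries.C (-c⁻¹) * X 1] : Fin 2 → MvPowerSeries (Fin 2) k) F)) = weightedOrder ![M, N] F := by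
  rw [weightedOrder_subst_shift M N hh₂ hN, weightedOrder_subst_tau hc hMN]

/-- In particular the two tuples have the same zero slots. -/
theorem subst_shift_subst_tau_eq_zero_iff {c : k} (hc : c ≠ 0) {h₂ : PowerSeries k} (hh₂ : PowerSeries.constantCoeff h₂ = 0)
    (h2 : (1 : ℕ∞) ≤ h₂.order) (F : MvPowerSeries (Fin 2) k) :
    subst (PurePowerFlag.shift h₂) (subst (![X 1 + MvPowerSeries.C c * X 0, MvPowerSeries.C (-c⁻¹) * X 1] : Fin 2 → MvPowerSeries (Fin 2) k) F) = 0 ↔ F = 0 := by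
  rw [eq_zero_iff_weightedOrder_eq_top ![1, 1], eq_zero_iff_weightedOrder_eq_top ![1, 1] F,
    weightedOrder_subst_shift_subst_tau hc hh₂ le_rfl (by simpa using h2)]

/-- **THE `n = 1` NUMBERS OF THE TWO PRESENTATIONS AGREE** (`ord h₂ ≥ 2`): `mFlagN L 1` and `dFlagN L 1` of the Newton sets of
`flagTuple d (swapT B) g (c·X + h₂)` and of `flagTuple d B (subst (![MvPowerSeries.C c⁻¹ * X 0 + X 1, MvPowerSeries.C (-c) * X 1] : Fin 2 → MvPowerSeries (Fin 2) k) (subst (PurePowerFlag.shift (-h₂)) g)) (c⁻¹·X)`. -/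
theorem mFlagN_dFlagN_eq_of_presentation {c : k} (hc : c ≠ 0) {h₂ : PowerSeries k} (hh₂ : PowerSeries.constantCoeff h₂ = 0)
    (h2 : (2 : ℕ∞) ≤ h₂.order) (L : ℕ) (B : Fin d → MvPowerSeries (Fin 2) k) (g : MvPowerSeries (Fin 2) k) :
    mFlagN L 1 (newtonSet (flagTuple d (swapT B) g (PowerSeries.C c * PowerSeries.X + h₂))) =
        mFlagN L 1 (newtonSet (flagTuple d B (subst (![MvPowerSeries.C c⁻¹ * X 0 + X 1, MvPowerSeries.C (-c) * X 1] : Fin 2 → MvPowerSeries (Fin 2) k) (subst (PurePowerFlag.shift (-h₂)) g)) (PowerSeries.C c⁻¹ * PowerSeries.X))) ∧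
      dFlagN L 1 (newtonSet (flagTuple d (swapT B) g (PowerSeries.C c * PowerSeries.X + h₂))) =
        dFlagN L 1 (newtonSet (flagTuple d B (subst (![MvPowerSeries.C c⁻¹ * X 0 + X 1, MvPowerSeries.C (-c) * X 1] : Fin 2 → MvPowerSeries (Fin 2) k) (subst (PurePowerFlag.shift (-h₂)) g)) (PowerSeries.C c⁻¹ * PowerSeries.X))) := by
  rw [flagTuple_swapT_linShift_add hc B g hh₂]
  refine mFlagN_one_eq_and_dFlagN_one_eq L (wMin_congr _ fun j => ?_) (fun K hK => wMin_congr _ fun j => ?_) (fun j => ?_)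
  · exact weightedOrder_subst_shift_subst_tau hc hh₂ le_rfl (by simpa using le_trans (by norm_num) h2) _
  · refine weightedOrder_subst_shift_subst_tau hc hh₂ (by omega) ?_ _
    have : ((K * 1 + 1 : ℕ) : ℕ∞) ≤ (K : ℕ∞) * 2 := by
      have h' : K * 1 + 1 ≤ K * 2 := by omega
      exact_mod_cast h'
    have h3 : (K : ℕ∞) * 2 ≤ (K : ℕ∞) * h₂.order := by gcongr
    exact this.trans h3
  · exact subst_shift_subst_tau_eq_zero_iff hc hh₂ (le_trans (by norm_num) h2) _

end Change

end WildMonic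

end Summit.ResolutionOfSingularities.ResolutionOfSingularities.Theorems

end
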